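import Literature.Probability.NegativeDependence.ProperPositionStochasticDomination
import Literature.Combinatorics.StablePolynomials.Homogenization
import Literature.Combinatorics.StablePolynomials.SamePhase
import Literature.Combinatorics.StablePolynomials.PderivProperPosition
import Literature.Combinatorics.StablePolynomials.Limits
import HarnessLib

/-!
# Truncations of strongly Rayleigh measures: `μ_{p,q}` stays strongly Rayleigh for `q - p ≤ 1` and
# `μ_{k-1} ≼ μ_k` (Borcea–Brändén–Liggett, Def. 2.15, Cor. 4.18, Thm. 4.19)

J. Borcea, P. Brändén, T. M. Liggett, *Negative dependence and the geometry of polynomials*, J. Amer. Math.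
Soc. 22 (2009) 521–567 (arXiv:0707.2340, held `paper:arxiv-0707.2340`; numbering of the arXiv version).
Verbatim:

> (§2.4) **Definition 2.15.** Let `μ ∈ 𝔓_n` and `1 ≤ p ≤ q ≤ n`. The truncation of `μ` to `[p,q]` is the
> conditional measure `μ_{p,q} = (μ | p ≤ Σ_i X_i ≤ q) ∈ 𝔓_n`, which is well defined provided that
> `μ({S ∈ 2^[n] : p ≤ |S| ≤ q}) ≠ 0`. The generating polynomial of `μ_{p,q}` is thus given by
> `g_{μ_{p,q}}(z) = g_{p,q}(z)/g_{p,q}(1,…,1)`, where `g_{p,q}(z) = Σ_{p ≤ |S| ≤ q} a_S z^S` and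
> `Σ_S a_S z^S = g_μ(z)`. For simplicity, we let `μ_k = μ_{k,k}`. […] **Conjecture 2.9** [Pemantle]. Suppose that
> `μ` is CNA+ and that `μ({|S| = k}) μ({|S| = k+1}) > 0`. Then `μ_k ≼ μ_{k+1}`.
>
> (§4.3.2) **Lemma 4.16.** Suppose that `f(z) = Σ_α a(α) z^α ∈ ℝ[z_1,…,z_n]` is stable of total degree at most
> `d` and has non-negative coefficients. For `0 ≤ k ≤ d` let `E_k(z) = Σ_{|α| = k} a(α) z^α`. If
> `0 ≤ p ≤ q ≤ d`, then `Σ_{k=p}^{q} binom(q-p, k-p) E_k(z) y^{q-k} / binom(d,k)` is a stable polynomial in the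
> variables `z_1,…,z_n,y`. *Proof.* `f_1(z,y) = Σ a(α) z^α y^{d-|α|} = Σ_k E_k(z) y^{d-k}`,
> `f_2 = ∂^{d-q} f_1/∂y^{d-q}`, `f_3 = y^q z_1^d ⋯ z_n^d f_2(z^{-1}, y^{-1})`, `f_4 = ∂^p f_3/∂y^p`, `f_5 = …`. By
> Theorem 4.5, `f_1` is a stable polynomial, and by the closure properties of stable polynomials we also have
> that `f_2, …, f_5` are stable. The polynomial `f_5` is a constant multiple of [the display]. □
>
> **Corollary 4.18.** Suppose that `μ` is a strongly Rayleigh probability measure on `2^[n]` and that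
> `0 ≤ p ≤ q ≤ n` with `q - p ≤ 1`. Then `μ_{p,q}` is strongly Rayleigh. *Proof.* We prove the corollary for
> `q - p = 1`. […] the polynomial `g(z,y) = E_p(z) y / binom(n,p) + E_q(z)/binom(n,q)` is stable. Clearly, the
> generating polynomial of `μ_{p,q}` is a (positive) constant multiple of `g(z, q/(n-p))`. The corollary follows
> since stable polynomials are closed under setting variables equal to real numbers. □
>
> **Theorem 4.19.** Let `μ` be a strongly Rayleigh probability measure on `2^[n]`, and let `1 ≤ k ≤ n`. If
> `μ({S : |S| = k-1}) μ({S : |S| = k}) ≠ 0`, then `μ_{k-1} ≼ μ_k`. *Proof.* Let `f` be the generating polynomial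
> of `μ` […]. By assumption one has `E_{k-1}(1) E_k(1) ≠ 0`. From Lemma 4.16 and the last part of Remark 4.1 we
> deduce that the polynomial `F(z_1,…,z_{n+1}) = z_{n+1} E_{k-1}(z)/E_{k-1}(1) + E_k(z)/E_k(1)` is stable. Since
> the above quotients are the generating polynomials of `μ_{k-1}` and `μ_k`, respectively, we have
> `μ_{k-1} ⊴ μ_k` by Theorem 4.11 and Definition 4.1. The desired conclusion follows from Proposition 4.12. □

## Transposition and scope

* Weights `μ : Finset σ → ℝ` (`ex`, `mass`, `StableOrZero`, `SRStep`/`SRLe'`/`SRLe`, `StochDom`) as in the sibling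
  files `FederMihail`, `StronglyRayleighNegativeAssociation`, `ProperPositionStochasticDomination`. `truncW p q μ`
  is the truncated weight (generating polynomial `g_{p,q}`), `truncMeasure p q μ = μ_{p,q}` the conditional
  measure (the zero weight when BBL's proviso `μ({p ≤ |S| ≤ q}) ≠ 0` fails). `E_k` is Mathlib's
  `homogeneousComponent k`; `multiAffine_truncW_self : g_{k,k} = E_k(g_μ)`.
* What Cor. 4.18 and Thm. 4.19 use from Lemma 4.16 is its case `q - p = 1` together with "the last part of
  Remark 4.1", i.e. **`E_{k-1} ≪ E_k`** (proper position, tree `IsProperPosition`; `F` stable ⟺ `E_{k-1} ≪ E_k` by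
  Thm. 4.11, tree `isProperPosition_iff_isRealStable_add_X_mul`). §1 proves exactly this
  (`isProperPosition_homogeneousComponent`) by a shortened form of BBL's chain: `f_1 = f_H` (tree
  `IsRealStable.homogenize` = Thm. 4.5), `f_2 = ∂_y^{d-k} f_1` (tree `IsUpperHalfPlaneStable.iterate_pderiv`),
  then instead of the inversions `f_3, f_4, f_5` the first part of Remark 4.1, `∂_y f_2 ≪ f_2` (tree
  `IsRealStable.isProperPosition_pderiv`), specialised at `y = 0` (tree `IsUpperHalfPlaneStable.specialize_real`,
  evaluated through `eval_iterate_pderiv_none_zero`): `(d-k+1)! E_{k-1} ≪ (d-k)! E_k`. When both parts vanish,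
  `≪` is undefined for BBL and false for the tree, whence the disjunction "`E_{k-1} = E_k = 0` or `E_{k-1} ≪ E_k`".
* -- TODO(general form): Lemma 4.16 for `q - p ≥ 2` and Cor. 4.17 (the Newton-type inequalities
  `E_k² / binom(d,k)² ≥ E_{k-1} E_{k+1} / (binom(d,k-1) binom(d,k+1))`) are not formalized here.
* Cor. 4.18, `q = p`: `E_p` is real stable or zero (COSW Cor. 2.10, tree `IsUpperHalfPlaneStable.optionEquivLeft_coeff`
  on `f_H`); `q = p + 1`: `E_p + E_{p+1}` is in the pencil of `E_p ≪ E_{p+1}` (Borcea–Brändén Thm. 1.9, tree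
  `IsProperPosition.pencil`) — this replaces "setting `y = q/(n-p)`".
* Thm. 4.19 exactly as printed: `g_{μ_{k-1}} = E_{k-1}/E_{k-1}(1) ≪ E_k/E_k(1) = g_{μ_k}` is one `SRStep`, so
  `μ_{k-1} ⊴′ μ_k` (`StableOrZero.srLe'_truncMeasure`), and Prop. 4.12 (`SRLe'.ex_le_ex`, `SRLe.stochDom`) gives
  `μ_{k-1} ≼ μ_k` for increasing functions, in the tree's `StochDom` form, and for increasing events.

## Contents

* §1 `optionEquivLeft_coeff_homogenize`, `eval_iterate_pderiv_homogenize_zero`,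
  **`isProperPosition_homogeneousComponent`** (`E_{k-1} ≪ E_k`), `eq_zero_or_isRealStable_homogeneousComponent`.
* §2 `truncW`, `truncMeasure` (Def. 2.15), `mass_truncMeasure`, `multiAffine_truncMeasure`,
  `multiAffine_truncW_self`, `multiAffine_truncW_succ`, `eq_zero_of_multiAffine_eq_zero`, `StableOrZero.const_mul`.
* §3 `stableOrZero_truncW_self`, `stableOrZero_truncW_succ`, **`stableOrZero_truncMeasure`** (Cor. 4.18).
* §4 `StableOrZero.srStep_truncMeasure`, `StableOrZero.srLe'_truncMeasure` (`μ_{k-1} ⊴′ μ_k`),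
  **`StableOrZero.ex_truncMeasure_le` / `StableOrZero.stochDom_truncMeasure` /
  `StableOrZero.truncMeasure_le_of_isUpperSet`** (Thm. 4.19), `stochDom_truncMeasure_of_isStronglyRayleighMeasure`.

## References

* [BorceaBrandenLiggett2007] J. Borcea, P. Brändén, T. M. Liggett, Negative dependence and the geometry of
  polynomials, J. Amer. Math. Soc. 22 (2009), 521–567; arXiv:0707.2340.
* [BorceaBranden2009] J. Borcea, P. Brändén, The Lee–Yang and Pólya–Schur programs I (proper position, Thm. 1.9).
* [ChoeOxleySokalWagner2004] Y.-B. Choe, J. Oxley, A. Sokal, D. Wagner, Homogeneous multivariate polynomials with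
  the half-plane property, Adv. Appl. Math. 32 (2004) (Cor. 2.10; tree `SamePhase.lean`).
-/

noncomputable section

open Finset MvPolynomial
open Literature.Combinatorics.Sahi2008
open Literature.Combinatorics.StablePolynomials
open Literature.Probability.MarkovChains (StochDom)

namespace Literature.Probability.NegativeDependence

variable {σ : Type*} [Fintype σ] [DecidableEq σ]

/-! ## §1 Consecutive homogeneous parts of a stable polynomial with nonnegative coefficients -/

section HomogeneousParts

omit [Fintype σ] [DecidableEq σ] in
/-- The coefficient polynomial of `y^j` in `f_H = Σ_k E_k(z) y^{d-k}` is `E_{d-j}` (`deg f ≤ d`, `j ≤ d`).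
[cite: BorceaBrandenLiggett2007, §4.3.2 proof of Lemma 4.16 ("`f_1(z,y) = Σ_k E_k(z) y^{d-k}`")] -/
theorem optionEquivLeft_coeff_homogenize {f : MvPolynomial σ ℝ} {d : ℕ} (hd : f.totalDegree ≤ d) {j : ℕ}
    (hj : j ≤ d) :
    (optionEquivLeft ℂ σ (map (algebraMap ℝ ℂ) (homogenize d f))).coeff j =
      map (algebraMap ℝ ℂ) (homogeneousComponent (d - j) f) := by
  ext n
  rw [optionEquivLeft_coeff_coeff, coeff_map, coeff_map, coeff_homogenize, coeff_homogeneousComponent,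
    Finsupp.optionElim_apply_none, Finsupp.some_optionElim]
  by_cases hn : n.degree = d - j
  · rw [if_pos hn, if_pos (by omega)]
  · rw [if_neg hn]
    by_cases hj' : j = d - n.degree
    · rw [if_pos hj']
      -- then `|n| > d`, so the coefficient vanishes
      have hlt : f.totalDegree < n.degree := by omega
      rw [coeff_eq_zero_of_totalDegree_lt hlt, map_zero]
    · rw [if_neg hj']

omit [Fintype σ] [DecidableEq σ] in
/-- `(∂_y^j f_H)(z, 0) = j! · E_{d-j}(z)` (COSW / tree `eval_iterate_pderiv_none_zero`).
[cite: BorceaBrandenLiggett2007, §4.3.2 proof of Lemma 4.16 (`f_2 = ∂^{d-q} f_1/∂y^{d-q}`)] -/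
theorem eval_iterate_pderiv_homogenize_zero {f : MvPolynomial σ ℝ} {d : ℕ} (hd : f.totalDegree ≤ d) {j : ℕ}
    (hj : j ≤ d) (z : σ → ℂ) :
    eval (fun o => Option.elim o 0 z) (map (algebraMap ℝ ℂ) ((pderiv none)^[j] (homogenize d f))) =
      (j.factorial : ℂ) * eval z (map (algebraMap ℝ ℂ) (homogeneousComponent (d - j) f)) := by
  have hcomm : ∀ i : ℕ, map (algebraMap ℝ ℂ) ((pderiv none)^[i] (homogenize d f)) =
      (pderiv none)^[i] (map (algebraMap ℝ ℂ) (homogenize d f)) := by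
    intro i
    induction i with
    | zero => rfl
    | succ i ih => rw [Function.iterate_succ_apply', Function.iterate_succ_apply', ← pderiv_map, ih]
  rw [hcomm, eval_iterate_pderiv_none_zero, optionEquivLeft_coeff_homogenize hd hj]

omit [Fintype σ] [DecidableEq σ] in
/-- A real polynomial pair with `a E(z) + i b E'(z) = 0` for all complex `z` (`a, b ≠ 0` real) vanishes.
[folklore] -/
private theorem eq_zero_of_eval_add_I_mul_eq_zero {E E' : MvPolynomial σ ℝ} {a b : ℝ} (ha : a ≠ 0) (hb : b ≠ 0)
    (h : ∀ z : σ → ℂ, (a : ℂ) * eval z (map (algebraMap ℝ ℂ) E) +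
      Complex.I * ((b : ℂ) * eval z (map (algebraMap ℝ ℂ) E')) = 0) :
    E = 0 ∧ E' = 0 := by
  have hP : C (a : ℂ) * map (algebraMap ℝ ℂ) E + C (Complex.I * b) * map (algebraMap ℝ ℂ) E' = 0 := by
    refine MvPolynomial.funext fun z => ?_
    rw [map_add, map_mul, map_mul, eval_C, eval_C, map_zero, mul_assoc]
    exact h z
  have hc : ∀ n, (a : ℂ) * ((coeff n E : ℝ) : ℂ) + Complex.I * b * ((coeff n E' : ℝ) : ℂ) = 0 := by
    intro n
    have := congrArg (coeff n) hP
    simpa only [coeff_add, coeff_C_mul, coeff_map, coeff_zero, Complex.coe_algebraMap] using this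
  constructor
  · ext n
    have h1 := congrArg Complex.re (hc n)
    simp only [Complex.add_re, Complex.mul_re, Complex.ofReal_re, Complex.ofReal_im, mul_zero, sub_zero,
      Complex.I_re, Complex.I_im, zero_mul, one_mul, Complex.mul_im, add_zero, Complex.zero_re] at h1
    rw [coeff_zero]
    have : a * coeff n E = 0 := by linarith
    exact (mul_eq_zero.1 this).resolve_left ha
  · ext n
    have h1 := congrArg Complex.im (hc n)
    simp only [Complex.add_im, Complex.mul_im, Complex.ofReal_re, Complex.ofReal_im, mul_zero, zero_mul,
      add_zero, Complex.I_re, Complex.I_im, Complex.mul_re, one_mul, sub_zero, zero_add, Complex.zero_im] at h1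
    rw [coeff_zero]
    have : b * coeff n E' = 0 := by linarith
    exact (mul_eq_zero.1 this).resolve_left hb

/-- **Consecutive homogeneous parts are in proper position** (the case `q - p = 1` of BBL Lemma 4.16, in the
form used by Thm. 4.19): if `f ∈ ℝ[z_1,…,z_n]` is real stable with non-negative coefficients and total degree
`≤ d`, and `1 ≤ k ≤ d`, then `E_{k-1} ≪ E_k` for the homogeneous parts `E_j` of `f` — unless both vanish.
Route (BBL's, shortened): `f_H(z,y) = Σ_j E_j(z) y^{d-j}` is real stable (Thm. 4.5, tree
`IsRealStable.homogenize`); `g = ∂_y^{d-k} f_H` is real stable or zero (Gauss–Lucas); `∂_y g ≪ g` (Remark 4.1,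
tree `IsRealStable.isProperPosition_pderiv`); specialising `y = 0` (tree `IsUpperHalfPlaneStable.specialize_real`)
gives `(d-k+1)! E_{k-1} ≪ (d-k)! E_k`. [cite: BorceaBrandenLiggett2007, §4.3.2 Lemma 4.16 (`p = k-1`, `q = k`)
and proof of Thm. 4.19 ("From Lemma 4.16 and the last part of Remark 4.1 … `F = z_{n+1} E_{k-1}/E_{k-1}(1) +
E_k/E_k(1)` is stable")] -/
theorem isProperPosition_homogeneousComponent {f : MvPolynomial σ ℝ} (hf : IsRealStable f)
    (hnn : ∀ m, 0 ≤ coeff m f) {d : ℕ} (hd : f.totalDegree ≤ d) {k : ℕ} (hk1 : 1 ≤ k) (hkd : k ≤ d) :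
    (homogeneousComponent (k - 1) f = 0 ∧ homogeneousComponent k f = 0) ∨
      IsProperPosition (homogeneousComponent (k - 1) f) (homogeneousComponent k f) := by
  classical
  set m := d - k with hm
  have hkm : d - m = k := by omega
  have hkm1 : d - (m + 1) = k - 1 := by omega
  set fH := homogenize d f with hfH
  have hH : IsRealStable fH := hf.homogenize hnn hd
  set g := (pderiv none)^[m] fH with hg
  -- the values of `g` and `∂_y g` on the slice `y = 0`
  have hval0 : ∀ z : σ → ℂ, eval (fun o => Option.elim o 0 z) (map (algebraMap ℝ ℂ) g) =
      (m.factorial : ℂ) * eval z (map (algebraMap ℝ ℂ) (homogeneousComponent k f)) := by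
    intro z
    rw [hg, eval_iterate_pderiv_homogenize_zero hd (by omega), hkm]
  have hval1 : ∀ z : σ → ℂ, eval (fun o => Option.elim o 0 z) (map (algebraMap ℝ ℂ) (pderiv none g)) =
      ((m + 1).factorial : ℂ) * eval z (map (algebraMap ℝ ℂ) (homogeneousComponent (k - 1) f)) := by
    intro z
    have : pderiv none g = (pderiv none)^[m + 1] fH := by rw [Function.iterate_succ_apply', hg]
    rw [this, eval_iterate_pderiv_homogenize_zero hd (by omega), hkm1]
  have hm0 : (m.factorial : ℝ) ≠ 0 := Nat.cast_ne_zero.2 (Nat.factorial_ne_zero m)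
  have hm1 : ((m + 1).factorial : ℝ) ≠ 0 := Nat.cast_ne_zero.2 (Nat.factorial_ne_zero (m + 1))
  -- the combination `G = g + i ∂_y g` evaluated on the slice
  have hGval : ∀ z : σ → ℂ, eval (fun o => Option.elim o 0 z)
      (map (algebraMap ℝ ℂ) g + C Complex.I * map (algebraMap ℝ ℂ) (pderiv none g)) =
      (m.factorial : ℂ) * eval z (map (algebraMap ℝ ℂ) (homogeneousComponent k f)) +
        Complex.I * (((m + 1).factorial : ℂ) * eval z (map (algebraMap ℝ ℂ) (homogeneousComponent (k - 1) f))) := by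
    intro z
    rw [map_add, map_mul, eval_C, hval0, hval1]
  -- the zero alternative
  have hzero : (∀ z : σ → ℂ, (m.factorial : ℂ) * eval z (map (algebraMap ℝ ℂ) (homogeneousComponent k f)) +
      Complex.I * (((m + 1).factorial : ℂ) * eval z (map (algebraMap ℝ ℂ) (homogeneousComponent (k - 1) f))) = 0) →
      homogeneousComponent (k - 1) f = 0 ∧ homogeneousComponent k f = 0 := by
    intro h
    have := eq_zero_of_eval_add_I_mul_eq_zero (E := homogeneousComponent k f)
      (E' := homogeneousComponent (k - 1) f) hm0 hm1 (by exact_mod_cast h)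
    exact ⟨this.2, this.1⟩
  have hupd : ∀ z : σ → ℂ, Function.update (fun o : Option σ => Option.elim o Complex.I z) none 0 =
      fun o => Option.elim o 0 z := by
    intro z
    funext o
    rcases o with _ | i
    · simp
    · simp
  by_cases hg0 : g = 0
  · left
    refine hzero fun z => ?_
    rw [← hGval, hg0]
    simp
  · -- `g` is real stable, `∂_y g ≪ g`, and we specialise `y = 0`
    have hgst : IsRealStable g := by
      have h := (IsUpperHalfPlaneStable.iterate_pderiv hH none m).resolve_left ?_
      · -- `(∂_y)^m (map fH) = map g`
        have hcomm : (pderiv none)^[m] (map (algebraMap ℝ ℂ) fH) = map (algebraMap ℝ ℂ) g := by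
          rw [hg]
          clear hval0 hval1 hGval hg0 hg
          induction m with
          | zero => rfl
          | succ i ih => rw [Function.iterate_succ_apply', Function.iterate_succ_apply', ih, pderiv_map]
        rwa [hcomm] at h
      · intro h0
        apply hg0
        have hcomm : (pderiv none)^[m] (map (algebraMap ℝ ℂ) fH) = map (algebraMap ℝ ℂ) g := by
          rw [hg]
          clear hval0 hval1 hGval hg0 hg h0
          induction m with
          | zero => rfl
          | succ i ih => rw [Function.iterate_succ_apply', Function.iterate_succ_apply', ih, pderiv_map]
        rw [hcomm] at h0
        exact map_injective _ (RingHom.injective _) (by rw [h0, map_zero])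
    have hPP : IsProperPosition (pderiv none g) g := hgst.isProperPosition_pderiv none
    -- specialise `y = 0`
    set G := map (algebraMap ℝ ℂ) g + C Complex.I * map (algebraMap ℝ ℂ) (pderiv none g) with hG
    have hGst : IsUpperHalfPlaneStable G := hPP
    rcases hGst.specialize_real none 0 with hS0 | hSst
    · left
      refine hzero fun z => ?_
      have h := congrArg (eval (fun o => Option.elim o Complex.I z)) hS0
      rw [map_zero, Complex.ofReal_zero, eval_bind₁_update, hupd] at h
      rw [← hGval, h]
    · right
      have key : IsProperPosition (C ((m + 1).factorial : ℝ) * homogeneousComponent (k - 1) f)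
          (C (m.factorial : ℝ) * homogeneousComponent k f) := by
        rw [isProperPosition_iff_forall]
        intro z hz
        have h := hSst (fun o => Option.elim o Complex.I z) (by rintro (_ | i) <;> simp [hz])
        rw [Complex.ofReal_zero, eval_bind₁_update, hupd, hGval] at h
        simpa only [map_mul, map_C, eval_C, Complex.coe_algebraMap, Complex.ofReal_natCast] using h
      exact (isProperPosition_C_mul_iff (by exact_mod_cast Nat.factorial_pos (m + 1))
        (by exact_mod_cast Nat.factorial_pos m) _ _).1 key

omit [DecidableEq σ] in
/-- **Homogeneous parts of a real stable polynomial with non-negative coefficients are real stable or zero**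
(`E_k = (1/(d-k)!) ∂_y^{d-k} f_H |_{y=0}`; COSW Cor. 2.10, tree `IsUpperHalfPlaneStable.optionEquivLeft_coeff`).
[cite: BorceaBrandenLiggett2007, §4.3.2 proof of Cor. 4.18 (case `q = p`: "`μ_{p,p}` is strongly Rayleigh")] -/
theorem eq_zero_or_isRealStable_homogeneousComponent {f : MvPolynomial σ ℝ} (hf : IsRealStable f)
    (hnn : ∀ m, 0 ≤ coeff m f) (k : ℕ) :
    homogeneousComponent k f = 0 ∨ IsRealStable (homogeneousComponent k f) := by
  classical
  by_cases hk : k ≤ f.totalDegree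
  · set d := f.totalDegree
    have hH : IsRealStable (homogenize d f) := hf.homogenize hnn le_rfl
    have h := IsUpperHalfPlaneStable.optionEquivLeft_coeff hH (d - k)
    rw [optionEquivLeft_coeff_homogenize le_rfl (Nat.sub_le d k), Nat.sub_sub_self hk] at h
    rcases h with h0 | hst
    · left
      exact map_injective _ (RingHom.injective _) (by rw [h0, map_zero])
    · exact Or.inr hst
  · left
    exact homogeneousComponent_eq_zero _ _ (not_le.1 hk)

end HomogeneousParts

/-! ## §2 Truncations `μ_{p,q}` (Def. 2.15) and their generating polynomials -/

section Truncation

omit [Fintype σ] [DecidableEq σ] in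
/-- `z^S` as a monomial, any coefficients. [folklore] -/
private theorem trunc_prod_X_eq_monomial {R : Type*} [CommSemiring R] (S : Finset σ) :
    (∏ i ∈ S, X i : MvPolynomial σ R) = monomial (∑ i ∈ S, Finsupp.single i 1) 1 := by
  classical
  induction S using Finset.induction_on with
  | empty => rw [Finset.prod_empty, Finset.sum_empty]; rfl
  | insert i S hi ih =>
    rw [Finset.prod_insert hi, Finset.sum_insert hi, ih, monomial_single_add, pow_one]

omit [Fintype σ] [DecidableEq σ] in
/-- `|𝟙_S| = |S|`. [folklore] -/
private theorem trunc_degree_indicator (S : Finset σ) :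
    (∑ i ∈ S, Finsupp.single i 1 : σ →₀ ℕ).degree = S.card := by
  classical
  induction S using Finset.induction_on with
  | empty => simp
  | insert i S hi ih => rw [Finset.sum_insert hi, map_add, ih, Finsupp.degree_single,
      Finset.card_insert_of_notMem hi, add_comm]

/-- Coefficients of `Σ_S a(S) z^S`, any coefficients. [folklore] -/
private theorem trunc_coeff_multiAffine {R : Type*} [CommSemiring R] (a : Finset σ → R) (n : σ →₀ ℕ) :
    coeff n (multiAffine a) = ∑ S : Finset σ, if (∑ i ∈ S, Finsupp.single i 1) = n then a S else 0 := by
  classical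
  simp only [multiAffine, coeff_sum]
  refine Finset.sum_congr rfl fun S _ => ?_
  rw [trunc_prod_X_eq_monomial, C_mul_monomial, mul_one, coeff_monomial]

/-- **Truncated weight** (BBL Def. 2.15, unnormalised): `μ` restricted to the sets `S` with `p ≤ |S| ≤ q`; its
generating polynomial is BBL's `g_{p,q}(z) = Σ_{p ≤ |S| ≤ q} a_S z^S`. [cite: BorceaBrandenLiggett2007, §2.4
Def. 2.15 (`g_{p,q}`)] -/
def truncW (p q : ℕ) (μ : Finset σ → ℝ) : Finset σ → ℝ := fun S => if p ≤ S.card ∧ S.card ≤ q then μ S else 0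

omit [Fintype σ] [DecidableEq σ] in
/-- Unfolding `truncW`. [cite: BorceaBrandenLiggett2007, §2.4 Def. 2.15] -/
theorem truncW_apply (p q : ℕ) (μ : Finset σ → ℝ) (S : Finset σ) :
    truncW p q μ S = if p ≤ S.card ∧ S.card ≤ q then μ S else 0 := rfl

omit [Fintype σ] [DecidableEq σ] in
/-- Truncation keeps nonnegativity. [cite: BorceaBrandenLiggett2007, §2.4 Def. 2.15] -/
theorem truncW_nonneg {μ : Finset σ → ℝ} (h0 : ∀ S, 0 ≤ μ S) (p q : ℕ) (S : Finset σ) : 0 ≤ truncW p q μ S := by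
  rw [truncW_apply]
  split_ifs
  · exact h0 S
  · exact le_rfl

/-- **The truncation `μ_{p,q} = (μ | p ≤ Σ X_i ≤ q)`** (BBL Def. 2.15), the conditional measure: the truncated
weight divided by its mass `g_{p,q}(1,…,1)` (the zero weight when that mass vanishes, where BBL leave `μ_{p,q}`
undefined). `μ_k = μ_{k,k}`. [cite: BorceaBrandenLiggett2007, §2.4 Def. 2.15] -/
def truncMeasure (p q : ℕ) (μ : Finset σ → ℝ) : Finset σ → ℝ := fun S => truncW p q μ S / mass (truncW p q μ)

omit [DecidableEq σ] in
/-- Unfolding `truncMeasure`. [cite: BorceaBrandenLiggett2007, §2.4 Def. 2.15] -/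
theorem truncMeasure_apply (p q : ℕ) (μ : Finset σ → ℝ) (S : Finset σ) :
    truncMeasure p q μ S = truncW p q μ S / mass (truncW p q μ) := rfl

omit [DecidableEq σ] in
/-- `μ_{p,q} ≥ 0` for `μ ≥ 0`. [cite: BorceaBrandenLiggett2007, §2.4 Def. 2.15] -/
theorem truncMeasure_nonneg {μ : Finset σ → ℝ} (h0 : ∀ S, 0 ≤ μ S) (p q : ℕ) (S : Finset σ) :
    0 ≤ truncMeasure p q μ S :=
  div_nonneg (truncW_nonneg h0 p q S) (mass_nonneg (truncW_nonneg h0 p q))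

omit [DecidableEq σ] in
/-- `μ_{p,q}` is a probability measure when `μ({p ≤ |S| ≤ q}) ≠ 0`. [cite: BorceaBrandenLiggett2007, §2.4
Def. 2.15 ("well defined provided that `μ({S : p ≤ |S| ≤ q}) ≠ 0`")] -/
theorem mass_truncMeasure {μ : Finset σ → ℝ} {p q : ℕ} (h : mass (truncW p q μ) ≠ 0) :
    mass (truncMeasure p q μ) = 1 := by
  rw [mass]
  simp only [truncMeasure_apply]
  rw [← Finset.sum_div, ← mass, div_self h]

omit [DecidableEq σ] in
/-- `g_{μ_{p,q}} = g_{p,q} / g_{p,q}(1,…,1)`. [cite: BorceaBrandenLiggett2007, §2.4 Def. 2.15] -/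
theorem multiAffine_truncMeasure (p q : ℕ) (μ : Finset σ → ℝ) :
    multiAffine (truncMeasure p q μ) = C (mass (truncW p q μ))⁻¹ * multiAffine (truncW p q μ) := by
  simp only [multiAffine, Finset.mul_sum, truncMeasure_apply]
  refine Finset.sum_congr rfl fun S _ => ?_
  rw [← mul_assoc, ← C_mul, div_eq_inv_mul]

omit [DecidableEq σ] in
/-- **`g_{k,k} = E_k`**: the generating polynomial of the rank-`k` truncation is the `k`-th homogeneous part of
`g_μ`. [cite: BorceaBrandenLiggett2007, §2.4 Def. 2.15 and §4.3.2 proof of Thm. 4.19 ("the above quotients are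
the generating polynomials of `μ_{k-1}` and `μ_k`")] -/
theorem multiAffine_truncW_self (k : ℕ) (μ : Finset σ → ℝ) :
    multiAffine (truncW k k μ) = homogeneousComponent k (multiAffine μ) := by
  classical
  ext n
  rw [coeff_homogeneousComponent, trunc_coeff_multiAffine, trunc_coeff_multiAffine]
  by_cases hn : n.degree = k
  · rw [if_pos hn]
    refine Finset.sum_congr rfl fun S _ => ?_
    by_cases hS : (∑ i ∈ S, Finsupp.single i 1 : σ →₀ ℕ) = n
    · have hc : S.card = k := by rw [← hn, ← hS, trunc_degree_indicator]
      rw [if_pos hS, if_pos hS, truncW_apply, if_pos ⟨hc.ge, hc.le⟩]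
    · rw [if_neg hS, if_neg hS]
  · rw [if_neg hn]
    refine Finset.sum_eq_zero fun S _ => ?_
    by_cases hS : (∑ i ∈ S, Finsupp.single i 1 : σ →₀ ℕ) = n
    · have hc : S.card ≠ k := by rw [← trunc_degree_indicator S, hS]; exact hn
      rw [if_pos hS, truncW_apply, if_neg fun h => hc (le_antisymm h.2 h.1)]
    · rw [if_neg hS]

omit [DecidableEq σ] in
/-- **`g_{p,p+1} = E_p + E_{p+1}`.** [cite: BorceaBrandenLiggett2007, §4.3.2 proof of Cor. 4.18 ("the generating
polynomial of `μ_{p,q}` is a (positive) constant multiple of `g(z, q/(n-p))`")] -/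
theorem multiAffine_truncW_succ (p : ℕ) (μ : Finset σ → ℝ) :
    multiAffine (truncW p (p + 1) μ) =
      homogeneousComponent p (multiAffine μ) + homogeneousComponent (p + 1) (multiAffine μ) := by
  classical
  rw [← multiAffine_truncW_self, ← multiAffine_truncW_self]
  simp only [multiAffine, ← Finset.sum_add_distrib, ← add_mul, ← C_add]
  refine Finset.sum_congr rfl fun S _ => ?_
  congr 2
  simp only [truncW_apply]
  by_cases h1 : S.card = p
  · rw [if_pos ⟨h1.ge, by omega⟩, if_pos ⟨h1.ge, h1.le⟩, if_neg (by omega), add_zero]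
  · by_cases h2 : S.card = p + 1
    · rw [if_pos ⟨by omega, h2.le⟩, if_neg (by omega), if_pos ⟨h2.ge, h2.le⟩, zero_add]
    · rw [if_neg (by omega), if_neg (by omega), if_neg (by omega), add_zero]

omit [DecidableEq σ] in
/-- A weight with vanishing generating polynomial is zero. [cite: BorceaBranden2009, §2.1 (`a(S)` is the
coefficient of `z^S`)] -/
theorem eq_zero_of_multiAffine_eq_zero {a : Finset σ → ℝ} (h : multiAffine a = 0) (S : Finset σ) : a S = 0 := by
  classical
  have hc := congrArg (coeff (∑ i ∈ S, Finsupp.single i 1)) h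
  rw [trunc_coeff_multiAffine, coeff_zero, Finset.sum_eq_single S] at hc
  · rwa [if_pos rfl] at hc
  · intro T _ hT
    rw [if_neg fun h' => hT (eq_of_sum_single_one_eq h')]
  · intro hS
    exact absurd (Finset.mem_univ S) hS

omit [DecidableEq σ] in
/-- Scaling a weight by a real constant keeps "stable or zero". [cite: BorceaBrandenLiggett2007, §2.1 Remark 2.1
(normalization factors)] -/
theorem StableOrZero.const_mul {μ : Finset σ → ℝ} (h : StableOrZero μ) (c : ℝ) :
    StableOrZero (fun S => c * μ S) := by
  by_cases hc : c = 0
  · exact Or.inl fun S => by simp only [hc, zero_mul]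
  rcases h with hz | hne
  · exact Or.inl fun S => by simp only [hz S, mul_zero]
  · right
    intro z hz
    have hsum : (∑ S : Finset σ, ((c * μ S : ℝ) : ℂ) * ∏ i ∈ S, z i) = (c : ℂ) * ∑ S : Finset σ, (μ S : ℂ) * ∏ i ∈ S, z i := by
      rw [Finset.mul_sum]
      refine Finset.sum_congr rfl fun S _ => ?_
      push_cast
      ring
    rw [hsum]
    exact mul_ne_zero (by exact_mod_cast hc) (hne z hz)

end Truncation

/-! ## §3 Corollary 4.18: truncations of length `≤ 1` stay strongly Rayleigh -/

section Cor418

omit [DecidableEq σ] in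
/-- **Rank truncations `μ_k` are strongly Rayleigh (or zero)** — Cor. 4.18, case `q = p`: `E_k` is real stable or
zero. [cite: BorceaBrandenLiggett2007, §4.3.2 Cor. 4.18 (`q - p = 0`)] -/
theorem stableOrZero_truncW_self {μ : Finset σ → ℝ} (h : StableOrZero μ) (h0 : ∀ S, 0 ≤ μ S) (k : ℕ) :
    StableOrZero (truncW k k μ) := by
  rw [stableOrZero_iff, multiAffine_truncW_self]
  rcases (stableOrZero_iff μ).1 h with hz | hst
  · left
    rw [hz, map_zero]
  · exact eq_zero_or_isRealStable_homogeneousComponent hst (coeff_multiAffine_nonneg h0) k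

/-- **Truncations `μ_{p,p+1}` are strongly Rayleigh (or zero)** — Cor. 4.18, case `q = p + 1`: `E_p + E_{p+1}`
is in the pencil of the proper-position pair `E_p ≪ E_{p+1}` (Thm. 1.9 of Borcea–Brändén, tree
`IsProperPosition.pencil`; BBL: "`g(z, q/(n-p))`, stable polynomials are closed under setting variables equal
to real numbers"). [cite: BorceaBrandenLiggett2007, §4.3.2 Cor. 4.18 (`q - p = 1`) and its proof] -/
theorem stableOrZero_truncW_succ {μ : Finset σ → ℝ} (h : StableOrZero μ) (h0 : ∀ S, 0 ≤ μ S) (p : ℕ) :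
    StableOrZero (truncW p (p + 1) μ) := by
  classical
  rw [stableOrZero_iff, multiAffine_truncW_succ]
  rcases (stableOrZero_iff μ).1 h with hz | hst
  · left
    rw [hz, map_zero, map_zero, add_zero]
  · have hd : (multiAffine μ).totalDegree ≤ max (Fintype.card σ) (p + 1) :=
      (totalDegree_multiAffine_le μ).trans (le_max_left _ _)
    rcases isProperPosition_homogeneousComponent hst (coeff_multiAffine_nonneg h0) hd (k := p + 1)
      (by omega) (le_max_right _ _) with ⟨h1, h2⟩ | hpp
    · left
      rw [Nat.add_sub_cancel] at h1
      rw [h1, h2, add_zero]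
    · rw [Nat.add_sub_cancel] at hpp
      have key := hpp.pencil 1 1
      rwa [C_1, one_mul, one_mul] at key

/-- **Borcea–Brändén–Liggett, Corollary 4.18.** "Suppose that `μ` is a strongly Rayleigh probability measure on
`2^[n]` and that `0 ≤ p ≤ q ≤ n` with `q - p ≤ 1`. Then `μ_{p,q}` is strongly Rayleigh": for `μ ≥ 0` with stable
(or zero) generating polynomial and `q ≤ p + 1`, the truncation `μ_{p,q}` has stable (or zero) generating
polynomial. [cite: BorceaBrandenLiggett2007, §4.3.2 Cor. 4.18] -/
theorem stableOrZero_truncMeasure {μ : Finset σ → ℝ} (h : StableOrZero μ) (h0 : ∀ S, 0 ≤ μ S) {p q : ℕ}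
    (hpq : p ≤ q) (hqp : q ≤ p + 1) : StableOrZero (truncMeasure p q μ) := by
  have hW : StableOrZero (truncW p q μ) := by
    rcases Nat.eq_or_lt_of_le hpq with rfl | hlt
    · exact stableOrZero_truncW_self h h0 p
    · have hq : q = p + 1 := le_antisymm hqp hlt
      subst hq
      exact stableOrZero_truncW_succ h h0 p
  have e : truncMeasure p q μ = fun S => (mass (truncW p q μ))⁻¹ * truncW p q μ S := by
    funext S
    rw [truncMeasure_apply, div_eq_inv_mul]
  rw [e]
  exact hW.const_mul _

end Cor418

/-! ## §4 Theorem 4.19: `μ_{k-1} ⊴ μ_k`, hence `μ_{k-1} ≼ μ_k` -/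

section Thm419

omit [DecidableEq σ] in
/-- A non-empty rank layer forces `k ≤ n`. [folklore] -/
private theorem le_card_of_mass_truncW_ne_zero {μ : Finset σ → ℝ} {k : ℕ} (h : mass (truncW k k μ) ≠ 0) :
    k ≤ Fintype.card σ := by
  by_contra hk
  apply h
  refine Finset.sum_eq_zero fun S _ => ?_
  rw [truncW_apply, if_neg]
  intro hS
  exact hk (le_antisymm hS.2 hS.1 ▸ Finset.card_le_univ S)

/-- **`g_{μ_{k-1}} ≪ g_{μ_k}`** for a strongly Rayleigh weight with non-empty layers `k-1`, `k` (the stability of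
`F = z_{n+1} E_{k-1}/E_{k-1}(1) + E_k/E_k(1)`), i.e. one `SRStep μ_{k-1} μ_k`. [cite: BorceaBrandenLiggett2007,
§4.3.2 proof of Thm. 4.19 ("we have `μ_{k-1} ⊴ μ_k` by Theorem 4.11 and Definition 4.1")] -/
theorem StableOrZero.srStep_truncMeasure {μ : Finset σ → ℝ} (h : StableOrZero μ) (h0 : ∀ S, 0 ≤ μ S) {k : ℕ}
    (hk : 1 ≤ k) (hm₁ : mass (truncW (k - 1) (k - 1) μ) ≠ 0) (hm₂ : mass (truncW k k μ) ≠ 0) :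
    SRStep (truncMeasure (k - 1) (k - 1) μ) (truncMeasure k k μ) := by
  classical
  refine ⟨⟨truncMeasure_nonneg h0 _ _, mass_truncMeasure hm₁⟩, ⟨truncMeasure_nonneg h0 _ _, mass_truncMeasure hm₂⟩,
    ?_⟩
  have hst : IsRealStable (multiAffine μ) := by
    refine ((stableOrZero_iff μ).1 h).resolve_left fun hz => hm₂ ?_
    refine Finset.sum_eq_zero fun S _ => ?_
    rw [truncW_apply, eq_zero_of_multiAffine_eq_zero hz S, ite_self]
  have hkd : k ≤ Fintype.card σ := le_card_of_mass_truncW_ne_zero hm₂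
  rcases isProperPosition_homogeneousComponent hst (coeff_multiAffine_nonneg h0) (totalDegree_multiAffine_le μ)
    hk hkd with ⟨_, h2⟩ | hpp
  · exfalso
    apply hm₂
    rw [← multiAffine_truncW_self] at h2
    refine Finset.sum_eq_zero fun S _ => eq_zero_of_multiAffine_eq_zero h2 S
  · rw [multiAffine_truncMeasure, multiAffine_truncMeasure, multiAffine_truncW_self, multiAffine_truncW_self]
    exact (isProperPosition_C_mul_iff (inv_pos.2 ((mass_nonneg (truncW_nonneg h0 _ _)).lt_of_ne hm₁.symm))
      (inv_pos.2 ((mass_nonneg (truncW_nonneg h0 _ _)).lt_of_ne hm₂.symm)) _ _).2 hpp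

/-- **`μ_{k-1} ⊴′ μ_k`** (hence `μ_{k-1} ⊴ μ_k`, `SRLe'.srLe`). [cite: BorceaBrandenLiggett2007, §4.3.2 proof of
Thm. 4.19] -/
theorem StableOrZero.srLe'_truncMeasure {μ : Finset σ → ℝ} (h : StableOrZero μ) (h0 : ∀ S, 0 ≤ μ S) {k : ℕ}
    (hk : 1 ≤ k) (hm₁ : mass (truncW (k - 1) (k - 1) μ) ≠ 0) (hm₂ : mass (truncW k k μ) ≠ 0) :
    SRLe' (truncMeasure (k - 1) (k - 1) μ) (truncMeasure k k μ) :=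
  (h.srStep_truncMeasure h0 hk hm₁ hm₂).srLe'

/-- **Borcea–Brändén–Liggett, Theorem 4.19** (Pemantle's Conjecture 2.9 for strongly Rayleigh measures). "Let
`μ` be a strongly Rayleigh probability measure on `2^[n]`, and let `1 ≤ k ≤ n`. If
`μ({S : |S| = k-1}) μ({S : |S| = k}) ≠ 0`, then `μ_{k-1} ≼ μ_k`": `E_{μ_{k-1}} F ≤ E_{μ_k} F` for every increasing
`F`. [cite: BorceaBrandenLiggett2007, §4.3.2 Thm. 4.19] -/
theorem StableOrZero.ex_truncMeasure_le {μ : Finset σ → ℝ} (h : StableOrZero μ) (h0 : ∀ S, 0 ≤ μ S) {k : ℕ}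
    (hk : 1 ≤ k) (hm₁ : mass (truncW (k - 1) (k - 1) μ) ≠ 0) (hm₂ : mass (truncW k k μ) ≠ 0)
    {F : Finset σ → ℝ} (hF : Monotone F) :
    ex (truncMeasure (k - 1) (k - 1) μ) F ≤ ex (truncMeasure k k μ) F :=
  (h.srLe'_truncMeasure h0 hk hm₁ hm₂).ex_le_ex hF

/-- **Theorem 4.19, stochastic domination form**: `μ_{k-1} ≼ μ_k` (tree `StochDom`). [cite: BorceaBrandenLiggett2007,
§4.3.2 Thm. 4.19] -/
theorem StableOrZero.stochDom_truncMeasure {μ : Finset σ → ℝ} (h : StableOrZero μ) (h0 : ∀ S, 0 ≤ μ S) {k : ℕ}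
    (hk : 1 ≤ k) (hm₁ : mass (truncW (k - 1) (k - 1) μ) ≠ 0) (hm₂ : mass (truncW k k μ) ≠ 0) :
    StochDom (truncMeasure (k - 1) (k - 1) μ) (truncMeasure k k μ) :=
  fun _ hF => h.ex_truncMeasure_le h0 hk hm₁ hm₂ hF

/-- **Theorem 4.19 for increasing events** (Def. 2.14 form): `μ_{k-1}(𝒜) ≤ μ_k(𝒜)`, i.e.
`μ(𝒜 ∩ {|S| = k-1}) / μ({|S| = k-1}) ≤ μ(𝒜 ∩ {|S| = k}) / μ({|S| = k})`. [cite: BorceaBrandenLiggett2007, §4.3.2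
Thm. 4.19; §2.4 Def. 2.14] -/
theorem stableOrZero_truncMeasure_le_of_isUpperSet {μ : Finset σ → ℝ} (h : StableOrZero μ) (h0 : ∀ S, 0 ≤ μ S)
    {k : ℕ} (hk : 1 ≤ k) (hm₁ : mass (truncW (k - 1) (k - 1) μ) ≠ 0) (hm₂ : mass (truncW k k μ) ≠ 0)
    {𝒜 : Finset (Finset σ)} (h𝒜 : IsUpperSet (𝒜 : Set (Finset σ))) :
    ∑ S ∈ 𝒜, truncMeasure (k - 1) (k - 1) μ S ≤ ∑ S ∈ 𝒜, truncMeasure k k μ S :=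
  (h.srLe'_truncMeasure h0 hk hm₁ hm₂).srLe.sum_le_sum_of_isUpperSet h𝒜

/-- Theorem 4.19 in the tree's `Set`-indexed vocabulary (`IsStronglyRayleighMeasure`).
[cite: BorceaBrandenLiggett2007, §4.3.2 Thm. 4.19] -/
theorem stochDom_truncMeasure_of_isStronglyRayleighMeasure {μ : Set σ → ℝ}
    (h : Literature.Combinatorics.LorentzianPolynomials.IsStronglyRayleighMeasure μ) (h0 : ∀ S, 0 ≤ μ S) {k : ℕ}
    (hk : 1 ≤ k) (hm₁ : mass (truncW (k - 1) (k - 1) fun S : Finset σ => μ ↑S) ≠ 0)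
    (hm₂ : mass (truncW k k fun S : Finset σ => μ ↑S) ≠ 0) :
    StochDom (truncMeasure (k - 1) (k - 1) fun S : Finset σ => μ ↑S) (truncMeasure k k fun S : Finset σ => μ ↑S) :=
  ((isStronglyRayleighMeasure_iff_stableOrZero μ).1 h).stochDom_truncMeasure (fun _ => h0 _) hk hm₁ hm₂

end Thm419

end Literature.Probability.NegativeDependence

end
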